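import Mathlib
import HarnessLib
import Summits.ValiantsHypothesis.ValiantsHypothesis.Theorems.LacunarySymmetroidMatrixDescartesProductPlusOnePivotWindow
import Summits.ValiantsHypothesis.ValiantsHypothesis.Theorems.LacunarySymmetroidMatrixDescartesProductPlusOneOneChangeEveryK
import Summits.ValiantsHypothesis.ValiantsHypothesis.Theorems.LacunarySymmetroidMatrixDescartesProductPlusOneEulerSharpK
import Summits.ValiantsHypothesis.ValiantsHypothesis.Theorems.LacunarySymmetroidMatrixDescartesProductPlusOneCrossingInterlace

/-!
# ValiantsHypothesis / LacunarySymmetroid — crux `MatrixDescartes` (stmt-ValiantsHypothesis-18050, V1),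
# LINE (A) «product_plus_one»: PIVOTABLE companies are LINEAR — `Z₊(R_{l₀}) ≤ 2m + 1`, every `K`, every coupling, every support

The global count carried by ✓ `eulerNumeratorK_roots_Icc_le_one_of_pivot` (`…ProductPlusOnePivotWindow`).  Setting: rows
`f_j = Σ_l C a_{jl} X^{d_l}` (ANY `K`, ANY support), coupled letter `l₀`, SPLIT-SIGNED rows (letters below the coupled exponent `≥ 0`, above
`≤ 0`), c-free Euler numerator `R_{l₀} = Σ_j B_j ∏_{i≠j} f_i`, `P = ∏ f_j`, letter-fraction sums `A_l(x) = Σ_j a_{jl}·x^{d_{l₀}}/f_j(x)`.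
The company is PIVOTABLE when EVERY window `[z,z'] ⊂ (0,∞)` on which all rows keep a constant sign admits a pivot letter `l⋆` in the sense
of the pivot window law (letters above `d_{l⋆}` ahead-dominated, letters below passed-dominated on `[z,z']`, some letter off both exponents).

* `splitSigned_oneChangeK` — split-signed rows are one-change rows (negatives persist upward), so `Z₊(P) ≤ m` (✓ `card_posRoots_prod_le_of_oneChangeK`);
* `row_constSign_of_ne_zero_on_Icc` — a real polynomial without zero on `[z,z']` keeps a constant sign there (IVT);
* ★★★ `eulerNumeratorK_pos_roots_le_of_pivotable` — PIVOTABLE ⇒ `Z₊(R_{l₀}) ≤ 2·Z₊(P) + 1`: two positive zeros of `R_{l₀}` off the poles with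
  no pole strictly between them would lie in one constant-sign window carrying two zeros, against the pivot law (✓ `card_le_card_add_one_of_between`
  with separator set `Z₊(P)`; zeros AT poles are at most `Z₊(P)` more);
* ★★★ `eulerBoundPoly_pivotable` — hence `Z₊(R_{l₀}) ≤ 2m + 1`: an every-`K`, every-coupling, ratio-free LINEAR sector of `EulerBoundPoly` /
  `stub_polyLaw` (at `K = 3`, bottom coupling, it is the «all windows of type β» part of the AB-reduction; its complement — a window with no
  admissible pivot — is the research residue «type α» in every format).

HONEST FRAMING: a sector theorem; the type-α residue is untouched; closes NO stub by name; NOT `OneChangeFloorK3`, `EulerBoundK3`, `ClassRowK3Linear`,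
`PPOPolyLaw`, `ProductPlusOneMDR`, `MatrixDescartes`; `VP ≠ VNP` is NOT proved.  No definitions, no named facts, no sorry.

[folklore] IVT + the tree's interlacing count; no citation needed.
-/

set_option linter.dupNamespace false

namespace Summit.ValiantsHypothesis.ValiantsHypothesis.Theorems.LacunarySymmetroidMatrixDescartes

namespace ProductPlusOne

open Polynomial Finset
open scoped BigOperators

/-- Split-signed rows are one-change rows (negatives persist upward). [folklore] -/
theorem splitSigned_oneChangeK {K : ℕ} (d : Fin K → ℕ) (b : Fin K → ℝ) (l₀ : Fin K)
    (hlow : ∀ l, d l < d l₀ → 0 ≤ b l) (hup : ∀ l, d l₀ < d l → b l ≤ 0) :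
    (∀ l l' : Fin K, d l < d l' → 0 < b l → 0 ≤ b l') ∨ (∀ l l' : Fin K, d l < d l' → b l < 0 → b l' ≤ 0) := by
  right
  intro l l' hll' hl
  have h1 : d l₀ ≤ d l := by
    by_contra h; push Not at h
    exact absurd (hlow l h) (not_le.mpr hl)
  exact hup l' (lt_of_le_of_lt h1 hll')

/-- A real polynomial with no zero on `[z,z']` keeps a constant sign there (IVT). [folklore] -/
theorem row_constSign_of_ne_zero_on_Icc (g : ℝ[X]) {z z' : ℝ} (hzz' : z ≤ z')
    (hne : ∀ t ∈ Set.Icc z z', g.eval t ≠ 0) :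
    (∀ t ∈ Set.Icc z z', 0 < g.eval t) ∨ (∀ t ∈ Set.Icc z z', g.eval t < 0) := by
  have hcont : ∀ t, t ∈ Set.Icc z z' → ContinuousOn (fun s => g.eval s) (Set.Icc z t) :=
    fun t _ => g.continuous.continuousOn
  rcases lt_or_gt_of_ne (hne z (Set.left_mem_Icc.2 hzz')) with hz | hz
  · right
    intro t ht
    by_contra hge
    push Not at hge
    -- `g z < 0 ≤ g t`: IVT gives a zero in `[z,t] ⊆ [z,z']`
    obtain ⟨s, hs, hs0⟩ := intermediate_value_Icc ht.1 (hcont t ht) ⟨hz.le, hge⟩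
    exact hne s ⟨hs.1, hs.2.trans ht.2⟩ hs0
  · left
    intro t ht
    by_contra hle
    push Not at hle
    obtain ⟨s, hs, hs0⟩ := intermediate_value_Icc' ht.1 (hcont t ht) ⟨hle, hz.le⟩
    exact hne s ⟨hs.1, hs.2.trans ht.2⟩ hs0

/-- ★★★ **PIVOTABLE ⇒ `Z₊(R_{l₀}) ≤ 2·Z₊(P) + 1`** (every `K`, any support, every coupling). [this file's theorem] -/
theorem eulerNumeratorK_pos_roots_le_of_pivotable {m K : ℕ} (d : Fin K → ℕ) (a : Fin m → Fin K → ℝ) (l₀ : Fin K)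
    (hlow : ∀ j l, d l < d l₀ → 0 ≤ a j l) (hup : ∀ j l, d l₀ < d l → a j l ≤ 0)
    (hpiv : ∀ z z' : ℝ, 0 < z → z ≤ z' →
      (∀ j, (∀ t ∈ Set.Icc z z', 0 < (∑ l, C (a j l) * X ^ (d l) : ℝ[X]).eval t) ∨
        (∀ t ∈ Set.Icc z z', (∑ l, C (a j l) * X ^ (d l) : ℝ[X]).eval t < 0)) →
      ∃ lp : Fin K,
        (∀ x ∈ Set.Icc z z', ∀ l, d lp < d l →
          (d l < d l₀ → 0 < ∑ j, a j l * (x ^ (d l₀) / (∑ l', C (a j l') * X ^ (d l') : ℝ[X]).eval x)) ∧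
          (d l₀ < d l → ∑ j, a j l * (x ^ (d l₀) / (∑ l', C (a j l') * X ^ (d l') : ℝ[X]).eval x) < 0)) ∧
        (∀ x ∈ Set.Icc z z', ∀ l, d l < d lp →
          (d l < d l₀ → ∑ j, a j l * (x ^ (d l₀) / (∑ l', C (a j l') * X ^ (d l') : ℝ[X]).eval x) < 0) ∧
          (d l₀ < d l → 0 < ∑ j, a j l * (x ^ (d l₀) / (∑ l', C (a j l') * X ^ (d l') : ℝ[X]).eval x))) ∧
        (∃ l, d l ≠ d lp ∧ d l ≠ d l₀)) :
    ((∑ j, (∑ l, C (a j l * ((d l : ℝ) - d l₀)) * X ^ (d l)) * ∏ i ∈ Finset.univ.erase j, (∑ l, C (a i l) * X ^ (d l))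
        : ℝ[X]).roots.toFinset.filter (fun t => 0 < t)).card
      ≤ 2 * ((∏ j, ∑ l, C (a j l) * X ^ (d l) : ℝ[X]).roots.toFinset.filter (fun t => 0 < t)).card + 1 := by
  classical
  set P : ℝ[X] := ∏ j, ∑ l, C (a j l) * X ^ (d l) with hP
  set R : ℝ[X] := (∑ j, (∑ l, C (a j l * ((d l : ℝ) - d l₀)) * X ^ (d l)) *
      ∏ i ∈ Finset.univ.erase j, (∑ l, C (a i l) * X ^ (d l))) with hR
  set ZR := R.roots.toFinset.filter (fun t => 0 < t) with hZR
  set ZP := P.roots.toFinset.filter (fun t => 0 < t) with hZP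
  by_cases hP0 : P = 0
  · -- then `R = X·P′ − C·P = 0` and there is nothing to count
    have hR0 : R = 0 := by
      rw [hR, eulerNumerator_eq_general, ← hP, hP0]; simp
    have : ZR = ∅ := by rw [hZR, hR0, roots_zero, Multiset.toFinset_zero, Finset.filter_empty]
    rw [this, Finset.card_empty]; exact Nat.zero_le _
  -- split `ZR` into zeros at poles and zeros off the poles
  set T := ZR.filter (fun t => t ∉ ZP) with hTdef
  have hsplit : ZR.card ≤ (ZR.filter (fun t => t ∈ ZP)).card + T.card := by
    rw [hTdef, Finset.card_filter_add_card_filter_not]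
  have hAt : (ZR.filter (fun t => t ∈ ZP)).card ≤ ZP.card :=
    Finset.card_le_card (fun t ht => (Finset.mem_filter.mp ht).2)
  -- the interlacing: between two zeros off the poles lies a pole
  have hbetween : ∀ z ∈ T, ∀ z' ∈ T, z < z' → ∃ w ∈ ZP, z < w ∧ w < z' := by
    intro z hz z' hz' hzz'
    by_contra hno
    push Not at hno
    rw [hTdef, Finset.mem_filter] at hz hz'
    obtain ⟨hzR, hzP⟩ := hz
    obtain ⟨hz'R, hz'P⟩ := hz'
    have hz0 : 0 < z := (Finset.mem_filter.mp hzR).2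
    -- `P ≠ 0` on `[z, z']`
    have hPne : ∀ t ∈ Set.Icc z z', P.eval t ≠ 0 := by
      intro t ht hPt
      have ht0 : 0 < t := hz0.trans_le ht.1
      have htZP : t ∈ ZP := by
        rw [hZP, Finset.mem_filter, Multiset.mem_toFinset, mem_roots hP0]; exact ⟨hPt, ht0⟩
      rcases ht.1.eq_or_lt with h1 | h1
      · exact hzP (h1 ▸ htZP)
      rcases ht.2.eq_or_lt with h2 | h2
      · exact hz'P (h2 ▸ htZP)
      · exact absurd h2 (not_lt.mpr (hno t htZP h1))
    -- every row keeps a constant sign on `[z, z']`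
    have hrow : ∀ t ∈ Set.Icc z z', ∀ j, (∑ l, C (a j l) * X ^ (d l) : ℝ[X]).eval t ≠ 0 := by
      intro t ht j hj
      apply hPne t ht
      rw [hP, eval_prod]
      exact Finset.prod_eq_zero (Finset.mem_univ j) hj
    have hsign : ∀ j, (∀ t ∈ Set.Icc z z', 0 < (∑ l, C (a j l) * X ^ (d l) : ℝ[X]).eval t) ∨
        (∀ t ∈ Set.Icc z z', (∑ l, C (a j l) * X ^ (d l) : ℝ[X]).eval t < 0) :=
      fun j => row_constSign_of_ne_zero_on_Icc _ hzz'.le (fun t ht => hrow t ht j)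
    obtain ⟨lp, habove, hbelow, hex⟩ := hpiv z z' hz0 hzz'.le hsign
    have hle1 := eulerNumeratorK_roots_Icc_le_one_of_pivot d a l₀ lp hlow hup hz0 hsign habove hbelow hex
    -- but `z` and `z'` are two distinct zeros of `R` in `[z, z']`
    have hzin : z ∈ R.roots.toFinset.filter (fun t => z ≤ t ∧ t ≤ z') :=
      Finset.mem_filter.mpr ⟨(Finset.mem_filter.mp hzR).1, le_rfl, hzz'.le⟩
    have hz'in : z' ∈ R.roots.toFinset.filter (fun t => z ≤ t ∧ t ≤ z') :=
      Finset.mem_filter.mpr ⟨(Finset.mem_filter.mp hz'R).1, hzz'.le, le_rfl⟩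
    have h2 : 2 ≤ (R.roots.toFinset.filter (fun t => z ≤ t ∧ t ≤ z')).card := by
      have : ({z, z'} : Finset ℝ) ⊆ R.roots.toFinset.filter (fun t => z ≤ t ∧ t ≤ z') := by
        intro t ht
        rcases Finset.mem_insert.mp ht with rfl | ht
        · exact hzin
        · rw [Finset.mem_singleton] at ht; rw [ht]; exact hz'in
      have hcard : ({z, z'} : Finset ℝ).card = 2 := Finset.card_pair hzz'.ne
      exact hcard ▸ Finset.card_le_card this
    have hle1' : (R.roots.toFinset.filter (fun t => z ≤ t ∧ t ≤ z')).card ≤ 1 := hle1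
    omega
  have hT := card_le_card_add_one_of_between T ZP hbetween
  omega

/-- ★★★ **PIVOTABLE COMPANIES ARE LINEAR: `Z₊(R_{l₀}) ≤ 2m + 1`** (every `K`, any support, every coupling; split-signed rows). [this file's theorem] -/
theorem eulerBoundPoly_pivotable {m K : ℕ} (d : Fin K → ℕ) (a : Fin m → Fin K → ℝ) (l₀ : Fin K)
    (hlow : ∀ j l, d l < d l₀ → 0 ≤ a j l) (hup : ∀ j l, d l₀ < d l → a j l ≤ 0)
    (hpiv : ∀ z z' : ℝ, 0 < z → z ≤ z' →
      (∀ j, (∀ t ∈ Set.Icc z z', 0 < (∑ l, C (a j l) * X ^ (d l) : ℝ[X]).eval t) ∨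
        (∀ t ∈ Set.Icc z z', (∑ l, C (a j l) * X ^ (d l) : ℝ[X]).eval t < 0)) →
      ∃ lp : Fin K,
        (∀ x ∈ Set.Icc z z', ∀ l, d lp < d l →
          (d l < d l₀ → 0 < ∑ j, a j l * (x ^ (d l₀) / (∑ l', C (a j l') * X ^ (d l') : ℝ[X]).eval x)) ∧
          (d l₀ < d l → ∑ j, a j l * (x ^ (d l₀) / (∑ l', C (a j l') * X ^ (d l') : ℝ[X]).eval x) < 0)) ∧
        (∀ x ∈ Set.Icc z z', ∀ l, d l < d lp →
          (d l < d l₀ → ∑ j, a j l * (x ^ (d l₀) / (∑ l', C (a j l') * X ^ (d l') : ℝ[X]).eval x) < 0) ∧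
          (d l₀ < d l → 0 < ∑ j, a j l * (x ^ (d l₀) / (∑ l', C (a j l') * X ^ (d l') : ℝ[X]).eval x))) ∧
        (∃ l, d l ≠ d lp ∧ d l ≠ d l₀)) :
    ((∑ j, (∑ l, C (a j l * ((d l : ℝ) - d l₀)) * X ^ (d l)) * ∏ i ∈ Finset.univ.erase j, (∑ l, C (a i l) * X ^ (d l))
        : ℝ[X]).roots.toFinset.filter (fun t => 0 < t)).card ≤ 2 * m + 1 := by
  have h1 := eulerNumeratorK_pos_roots_le_of_pivotable d a l₀ hlow hup hpiv
  have h2 := card_posRoots_prod_le_of_oneChangeK d a (fun j => splitSigned_oneChangeK d (a j) l₀ (hlow j) (hup j))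
  omega

end ProductPlusOne

end Summit.ValiantsHypothesis.ValiantsHypothesis.Theorems.LacunarySymmetroidMatrixDescartes
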